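import Summits.Ventures.PercRepro.C041TriangleLeafStar6Sym

/-!
# THEOREM — the transversal sums as operators (mine-3, gen 71; C-041.md §21 (bl)): `T_k F x = Σ_{π ∈ T_k} F (πx)` for a function `F`
of the variables, additive and homogeneous, with `T_k (S_k e) = Sym e` (the landed transversal lemma). An orbit lemma is then the
member expansion (one small `ring`) pushed through `T_k` by rewriting — no `ring` over the members × classes atoms.
-/

namespace PercRepro

namespace RelaxedTriangle

open TreeClosure

/-- The transversal sum of stabiliser subgroup `1` applied to a function of the variables: `Σ_{π ∈ T_1} F (πx)` (6 members,
in the order of the landed transversal lemma). -/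
noncomputable def leafStar6T1 (F : ℝ → ℝ → ℝ → ℝ → ℝ → ℝ → ℝ → ℝ) (a b c d e f g : ℝ) : ℝ :=
  F a b c d e f g + F b a c d e f g + F c a b d e f g + F d a b c e f g + F e a b c d f g + F f a b c d e g

/-- The transversal sum is additive. -/
theorem leafStar6T1_add (F G : ℝ → ℝ → ℝ → ℝ → ℝ → ℝ → ℝ → ℝ) (a b c d e f g : ℝ) :
    leafStar6T1 (fun a b c d e f g => F a b c d e f g + G a b c d e f g) a b c d e f g = leafStar6T1 F a b c d e f g + leafStar6T1 G a b c d e f g := by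
  simp only [leafStar6T1]
  ring

/-- The transversal sum is homogeneous. -/
theorem leafStar6T1_smul (r : ℝ) (F : ℝ → ℝ → ℝ → ℝ → ℝ → ℝ → ℝ → ℝ) (a b c d e f g : ℝ) :
    leafStar6T1 (fun a b c d e f g => r * F a b c d e f g) a b c d e f g = r * leafStar6T1 F a b c d e f g := by
  simp only [leafStar6T1]
  ring

/-- The transversal sum of a stabiliser class is the symmetric sum (the landed transversal lemma). -/
theorem leafStar6T1_S (e1 e2 e3 e4 e5 e6 e7 : ℕ) (a b c d e f g : ℝ) :
    leafStar6T1 (fun a b c d e f g => leafStar6S1 e1 e2 e3 e4 e5 e6 e7 a b c d e f g) a b c d e f g = leafStar6Sym e1 e2 e3 e4 e5 e6 e7 a b c d e f g := by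
  simp only [leafStar6T1]
  exact leafStar6S1_trans e1 e2 e3 e4 e5 e6 e7 a b c d e f g

/-- The transversal sum of stabiliser subgroup `3` applied to a function of the variables: `Σ_{π ∈ T_3} F (πx)` (15 members,
in the order of the landed transversal lemma). -/
noncomputable def leafStar6T3 (F : ℝ → ℝ → ℝ → ℝ → ℝ → ℝ → ℝ → ℝ) (a b c d e f g : ℝ) : ℝ :=
  F a b c d e f g + F a c b d e f g + F a d b c e f g + F a e b c d f g + F a f b c d e g + F b c a d e f g + F b d a c e f g + F b e a c d f g + F b f a c d e g + F c d a b e f g + F c e a b d f g + F c f a b d e g + F d e a b c f g + F d f a b c e g + F e f a b c d g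

/-- The transversal sum is additive. -/
theorem leafStar6T3_add (F G : ℝ → ℝ → ℝ → ℝ → ℝ → ℝ → ℝ → ℝ) (a b c d e f g : ℝ) :
    leafStar6T3 (fun a b c d e f g => F a b c d e f g + G a b c d e f g) a b c d e f g = leafStar6T3 F a b c d e f g + leafStar6T3 G a b c d e f g := by
  simp only [leafStar6T3]
  ring

/-- The transversal sum is homogeneous. -/
theorem leafStar6T3_smul (r : ℝ) (F : ℝ → ℝ → ℝ → ℝ → ℝ → ℝ → ℝ → ℝ) (a b c d e f g : ℝ) :
    leafStar6T3 (fun a b c d e f g => r * F a b c d e f g) a b c d e f g = r * leafStar6T3 F a b c d e f g := by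
  simp only [leafStar6T3]
  ring

/-- The transversal sum of a stabiliser class is the symmetric sum (the landed transversal lemma). -/
theorem leafStar6T3_S (e1 e2 e3 e4 e5 e6 e7 : ℕ) (a b c d e f g : ℝ) :
    leafStar6T3 (fun a b c d e f g => leafStar6S3 e1 e2 e3 e4 e5 e6 e7 a b c d e f g) a b c d e f g = leafStar6Sym e1 e2 e3 e4 e5 e6 e7 a b c d e f g := by
  simp only [leafStar6T3]
  exact leafStar6S3_trans e1 e2 e3 e4 e5 e6 e7 a b c d e f g

/-- The transversal sum of stabiliser subgroup `4` applied to a function of the variables: `Σ_{π ∈ T_4} F (πx)` (30 members,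
in the order of the landed transversal lemma). -/
noncomputable def leafStar6T4 (F : ℝ → ℝ → ℝ → ℝ → ℝ → ℝ → ℝ → ℝ) (a b c d e f g : ℝ) : ℝ :=
  F a b c d e f g + F a c b d e f g + F a d b c e f g + F a e b c d f g + F a f b c d e g + F b a c d e f g + F b c a d e f g + F b d a c e f g + F b e a c d f g + F b f a c d e g + F c a b d e f g + F c b a d e f g + F c d a b e f g + F c e a b d f g + F c f a b d e g + F d a b c e f g + F d b a c e f g + F d c a b e f g + F d e a b c f g + F d f a b c e g + F e a b c d f g + F e b a c d f g + F e c a b d f g + F e d a b c f g + F e f a b c d g + F f a b c d e g + F f b a c d e g + F f c a b d e g + F f d a b c e g + F f e a b c d g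

/-- The transversal sum is additive. -/
theorem leafStar6T4_add (F G : ℝ → ℝ → ℝ → ℝ → ℝ → ℝ → ℝ → ℝ) (a b c d e f g : ℝ) :
    leafStar6T4 (fun a b c d e f g => F a b c d e f g + G a b c d e f g) a b c d e f g = leafStar6T4 F a b c d e f g + leafStar6T4 G a b c d e f g := by
  simp only [leafStar6T4]
  ring

/-- The transversal sum is homogeneous. -/
theorem leafStar6T4_smul (r : ℝ) (F : ℝ → ℝ → ℝ → ℝ → ℝ → ℝ → ℝ → ℝ) (a b c d e f g : ℝ) :
    leafStar6T4 (fun a b c d e f g => r * F a b c d e f g) a b c d e f g = r * leafStar6T4 F a b c d e f g := by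
  simp only [leafStar6T4]
  ring

/-- The transversal sum of a stabiliser class is the symmetric sum (the landed transversal lemma). -/
theorem leafStar6T4_S (e1 e2 e3 e4 e5 e6 e7 : ℕ) (a b c d e f g : ℝ) :
    leafStar6T4 (fun a b c d e f g => leafStar6S4 e1 e2 e3 e4 e5 e6 e7 a b c d e f g) a b c d e f g = leafStar6Sym e1 e2 e3 e4 e5 e6 e7 a b c d e f g := by
  simp only [leafStar6T4]
  exact leafStar6S4_trans e1 e2 e3 e4 e5 e6 e7 a b c d e f g


end RelaxedTriangle

end PercRepro
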